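import Mathlib

/-!
# Route StarvedNecks — crux `NecksCertify`, line `two-cap-focusing-ledger`: seam surgery, smoothing

Helper file for the registered stub `stub_seamSurgery` (N2).  Three one-dimensional `C^∞` devices
the chart surgery of the seam needs, all proved from Mathlib (`Real.smoothTransition`, interval
integrals), packaged as existence statements (no definitions):

* `exists_smooth_monotone_approx` (registered helper sub-goal `stub_seamSurgery_smoothing`):
  a continuous monotone function `f : ℝ → ℝ`, bounded below and tending to `+∞`, admits for every
  `ε > 0` a `C^∞` MONOTONE minorant `g ≤ f ≤ g + ε` (a smooth staircase: the level-crossing times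
  `aₖ = inf {f ≥ m₀ + (k+1)ε/2}` are strictly increasing to `+∞`, and
  `g = m₀ + (ε/2) Σₖ smoothTransition ((x − aₖ)/(aₖ₊₁ − aₖ))` is a locally finite sum).  The seam
  uses it to replace the continuous certified radii `Rgᵢ` of the atlas by smooth monotone shell
  radii (the radial squash of the far hole leaves must be smooth and monotone in hole time).
* `exists_squashProfile`: a `C^∞` strictly increasing `g : ℝ → ℝ` with `g u = u` for `u ≤ 0`,
  `g < 1/2`, `g v − g u ≤ v − u` (slope `≤ 1`), onto an interval `(−∞, L)`:
  `g u = ∫₀ᵘ (1 − smoothTransition (4v) (1 − e^{−4v})) dv`.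
* `exists_pushProfile`: a `C^∞` `ϑ : ℝ → ℝ` with `ϑ t = t` for `t ≥ a + 1`, `ϑ > a`, `ϑ ≥ id`
  (`ϑ t = t + (a + 1 − t)(1 − smoothTransition (t − a))`).

Mathlib only; no definitions, no named facts.
-/

noncomputable section

open scoped Topology ContDiff
open Filter Set MeasureTheory intervalIntegral

namespace Summit.FinalStateConjecture.FinalStateConjecture.Theorems.NecksCertifyTwoCap.Seam

set_option linter.dupNamespace false

/-! ## Smooth monotone approximation of a continuous monotone function -/

/-- **Smooth monotone staircase below a continuous monotone function** (registered helper
sub-goal `stub_seamSurgery_smoothing` of N2).  If `f : ℝ → ℝ` is continuous and monotone, bounded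
below and tends to `+∞`, then for every `ε > 0` there is a `C^∞` monotone `g` with
`g ≤ f ≤ g + ε`.  [folklore] -/
theorem stub_seamSurgery_smoothing :
    ∀ (f : ℝ → ℝ) (m ε : ℝ), Continuous f → Monotone f → (∀ x, m ≤ f x) →
      Tendsto f atTop atTop → 0 < ε →
      ∃ g : ℝ → ℝ, ContDiff ℝ ∞ g ∧ Monotone g ∧ ∀ x, g x ≤ f x ∧ f x ≤ g x + ε := by
  intro f m ε hf hmono hm htop hε
  set e : ℝ := ε / 2 with he
  have he0 : 0 < e := by positivity
  have hbdd : BddBelow (range f) := ⟨m, by rintro _ ⟨x, rfl⟩; exact hm x⟩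
  set m₀ : ℝ := ⨅ x, f x with hm₀
  have hm₀le : ∀ x, m₀ ≤ f x := fun x ↦ ciInf_le hbdd x
  have hm₀lt : ∀ δ, 0 < δ → ∃ x, f x < m₀ + δ := fun δ hδ ↦
    exists_lt_of_ciInf_lt (by linarith)
  -- levels and level-crossing times
  set ℓ : ℕ → ℝ := fun k ↦ m₀ + (k + 1) * e with hℓ
  have hℓpos : ∀ k, m₀ < ℓ k := fun k ↦ by
    simp only [hℓ]; nlinarith [he0, (k.cast_nonneg : (0 : ℝ) ≤ k)]
  set S : ℕ → Set ℝ := fun k ↦ {x | ℓ k ≤ f x} with hS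
  have hSne : ∀ k, (S k).Nonempty := fun k ↦
    (htop.eventually (eventually_ge_atTop (ℓ k))).exists
  have hSbdd : ∀ k, BddBelow (S k) := fun k ↦ by
    obtain ⟨x₀, hx₀⟩ := hm₀lt ((k + 1) * e) (by positivity)
    refine ⟨x₀, fun y hy ↦ ?_⟩
    by_contra hlt
    have : f y ≤ f x₀ := hmono (not_le.mp hlt).le
    exact absurd (hy.trans this) (not_le.mpr hx₀)
  have hScl : ∀ k, IsClosed (S k) := fun k ↦ isClosed_le continuous_const hf
  set a : ℕ → ℝ := fun k ↦ sInf (S k) with ha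
  have ha_mem : ∀ k, ℓ k ≤ f (a k) := fun k ↦ (hScl k).csInf_mem (hSne k) (hSbdd k)
  have ha_le : ∀ k x, ℓ k ≤ f x → a k ≤ x := fun k x hx ↦ csInf_le (hSbdd k) hx
  have hlt_a : ∀ k x, x < a k → f x < ℓ k := fun k x hx ↦ by
    by_contra h
    exact absurd (ha_le k x (not_lt.mp h)) (not_le.mpr hx)
  have hfa : ∀ k, f (a k) = ℓ k := fun k ↦ by
    refine le_antisymm ?_ (ha_mem k)
    have ht : Tendsto f (𝓝[<] (a k)) (𝓝 (f (a k))) :=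
      hf.continuousAt.continuousWithinAt.tendsto
    refine le_of_tendsto ht (eventually_nhdsWithin_of_forall fun y hy ↦ (hlt_a k y hy).le)
  have ha_lt : ∀ k, a k < a (k + 1) := fun k ↦ by
    by_contra h
    have h1 : f (a (k + 1)) ≤ f (a k) := hmono (not_lt.mp h)
    rw [hfa, hfa] at h1
    simp only [hℓ, Nat.cast_add, Nat.cast_one] at h1
    linarith
  have ha_mono : StrictMono a := strictMono_nat_of_lt_succ ha_lt
  have ha_big : ∀ X : ℝ, ∃ K : ℕ, X < a K := fun X ↦ by
    obtain ⟨K, hK⟩ := exists_nat_gt ((f X - m₀) / e)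
    refine ⟨K, ?_⟩
    by_contra h
    have h1 : ℓ K ≤ f X := (ha_mem K).trans (hmono (not_lt.mp h))
    simp only [hℓ] at h1
    rw [div_lt_iff₀ he0] at hK
    nlinarith
  -- the smooth steps
  set term : ℕ → ℝ → ℝ := fun k x ↦ Real.smoothTransition ((x - a k) / (a (k + 1) - a k))
    with hterm
  have hd : ∀ k, 0 < a (k + 1) - a k := fun k ↦ sub_pos.mpr (ha_lt k)
  have hterm0 : ∀ k x, x ≤ a k → term k x = 0 := fun k x hx ↦
    Real.smoothTransition.zero_of_nonpos (div_nonpos_of_nonpos_of_nonneg (by linarith) (hd k).le)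
  have hterm1 : ∀ k x, a (k + 1) ≤ x → term k x = 1 := fun k x hx ↦
    Real.smoothTransition.one_of_one_le ((one_le_div (hd k)).mpr (by linarith))
  have hterm_mono : ∀ k, Monotone (term k) := fun k x y hxy ↦
    Real.smoothTransition.monotone (div_le_div_of_nonneg_right (by linarith) (hd k).le)
  have hterm_nn : ∀ k x, 0 ≤ term k x := fun k x ↦ Real.smoothTransition.nonneg _
  have hterm_le : ∀ k x, term k x ≤ 1 := fun k x ↦ Real.smoothTransition.le_one _
  have hterm_cd : ∀ k, ContDiff ℝ ∞ (term k) := fun k ↦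
    Real.smoothTransition.contDiff.comp ((contDiff_id.sub contDiff_const).div_const _)
  -- the staircase
  set g : ℝ → ℝ := fun x ↦ m₀ + e * ∑' k, term k x with hg
  have hg_eq : ∀ (K : ℕ) (x : ℝ), x < a K →
      g x = m₀ + e * ∑ k ∈ Finset.range K, term k x := fun K x hx ↦ by
    simp only [hg]
    rw [tsum_eq_sum]
    intro k hk
    rw [Finset.mem_range, not_lt] at hk
    exact hterm0 k x (hx.trans_le (ha_mono.monotone hk)).le
  refine ⟨g, ?_, ?_, ?_⟩
  · -- smoothness: locally a finite sum
    refine contDiff_iff_contDiffAt.mpr fun x ↦ ?_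
    obtain ⟨K, hK⟩ := ha_big x
    have hF : ContDiff ℝ ∞ fun y ↦ m₀ + e * ∑ k ∈ Finset.range K, term k y :=
      contDiff_const.add (contDiff_const.mul (ContDiff.sum fun k _ ↦ hterm_cd k))
    refine hF.contDiffAt.congr_of_eventuallyEq ?_
    filter_upwards [isOpen_Iio.mem_nhds hK] with y hy
    exact hg_eq K y hy
  · -- monotonicity
    intro x y hxy
    obtain ⟨K, hK⟩ := ha_big y
    rw [hg_eq K x (hxy.trans_lt hK), hg_eq K y hK]
    have : ∑ k ∈ Finset.range K, term k x ≤ ∑ k ∈ Finset.range K, term k y :=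
      Finset.sum_le_sum fun k _ ↦ hterm_mono k hxy
    nlinarith
  · -- the two-sided bound
    intro x
    by_cases hx0 : x < a 0
    · rw [hg_eq 0 x hx0, Finset.sum_range_zero, mul_zero, add_zero]
      refine ⟨hm₀le x, ?_⟩
      have := hlt_a 0 x hx0
      simp only [hℓ, Nat.cast_zero, zero_add, one_mul] at this
      linarith
    · classical
      have hex : ∃ K, x < a K := ha_big x
      have hK : x < a (Nat.find hex) := Nat.find_spec hex
      have hK0 : Nat.find hex ≠ 0 := by
        intro h
        rw [h] at hK
        exact hx0 hK
      obtain ⟨k, hk⟩ := Nat.exists_eq_succ_of_ne_zero hK0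
      have hk' : ¬ x < a k := Nat.find_min hex (by rw [hk]; exact Nat.lt_succ_self k)
      rw [hk] at hK
      rw [not_lt] at hk'
      rw [hg_eq (k + 1) x hK, Finset.sum_range_succ]
      have hsum : ∑ j ∈ Finset.range k, term j x = k := by
        rw [Finset.sum_eq_card_nsmul (b := (1 : ℝ)) fun j hj ↦ ?_]
        · simp
        · rw [Finset.mem_range] at hj
          exact hterm1 j x ((ha_mono.monotone (Nat.succ_le_of_lt hj)).trans hk')
      rw [hsum]
      have h1 : ℓ k ≤ f x := (ha_mem k).trans (hmono hk')
      have h2 : f x < ℓ (k + 1) := hlt_a (k + 1) x hK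
      simp only [hℓ, Nat.cast_add, Nat.cast_one] at h1 h2
      have h3 := hterm_nn k x
      have h4 := hterm_le k x
      constructor <;> nlinarith

/-! ## The squash profile -/

/-- **Squash profile.**  There is a `C^∞` strictly increasing `g : ℝ → ℝ` with `g u = u` for
`u ≤ 0`, `g < 1/2`, slope at most one (`g v − g u ≤ v − u` for `u ≤ v`), mapping `ℝ` onto an
interval `(−∞, L)`: `g u = ∫₀ᵘ φ` with the smooth density
`φ v = 1 − smoothTransition (4v) · (1 − e^{−4v}) ∈ (0, 1]`, `φ = 1` on `(−∞, 0]`, `φ = e^{−4v}` on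
`[1/4, ∞)`.  The seam squashes the far hole leaves `{r ≥ b(t)}` radially onto the shell
`r ∈ [b(t), b(t) + 1/2)` by `r ↦ b(t) + g (r − b(t))`. [folklore] -/
theorem exists_squashProfile :
    ∃ g : ℝ → ℝ, ContDiff ℝ ∞ g ∧ StrictMono g ∧ (∀ u, u ≤ 0 → g u = u) ∧ (∀ u, g u < 1 / 2) ∧
      (∀ u v, u ≤ v → g v - g u ≤ v - u) ∧
      ∃ L : ℝ, (∀ u, g u < L) ∧ ∀ y, y < L → ∃ u, g u = y := by
  set φ : ℝ → ℝ := fun v ↦ 1 - Real.smoothTransition (4 * v) * (1 - Real.exp (-4 * v)) with hφ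
  have hφ_cd : ContDiff ℝ ∞ φ :=
    contDiff_const.sub ((Real.smoothTransition.contDiff.comp (contDiff_const.mul contDiff_id)).mul
      (contDiff_const.sub (Real.contDiff_exp.comp (contDiff_const.mul contDiff_id))))
  have hφ_cont : Continuous φ := hφ_cd.continuous
  have hφ_neg : ∀ v, v ≤ 0 → φ v = 1 := fun v hv ↦ by
    simp only [hφ, Real.smoothTransition.zero_of_nonpos (by linarith : 4 * v ≤ 0)]; ring
  have hφ_far : ∀ v, 1 / 4 ≤ v → φ v = Real.exp (-4 * v) := fun v hv ↦ by
    simp only [hφ, Real.smoothTransition.one_of_one_le (by linarith : 1 ≤ 4 * v)]; ring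
  have hφ_pos : ∀ v, 0 < φ v := fun v ↦ by
    rcases le_or_gt v 0 with hv | hv
    · rw [hφ_neg v hv]; exact one_pos
    · have h1 : Real.smoothTransition (4 * v) ≤ 1 := Real.smoothTransition.le_one _
      have h0 : 0 ≤ Real.smoothTransition (4 * v) := Real.smoothTransition.nonneg _
      have h2 : 0 < Real.exp (-4 * v) := Real.exp_pos _
      have h3 : Real.exp (-4 * v) < 1 := Real.exp_lt_one_iff.mpr (by linarith)
      simp only [hφ]
      nlinarith
  have hφ_le : ∀ v, φ v ≤ 1 := fun v ↦ by
    rcases le_or_gt v 0 with hv | hv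
    · rw [hφ_neg v hv]
    · have h0 : 0 ≤ Real.smoothTransition (4 * v) := Real.smoothTransition.nonneg _
      have h3 : Real.exp (-4 * v) ≤ 1 := Real.exp_le_one_iff.mpr (by linarith)
      simp only [hφ]
      nlinarith
  have hii : ∀ a b : ℝ, IntervalIntegrable φ volume a b := fun a b ↦ hφ_cont.intervalIntegrable a b
  set g : ℝ → ℝ := fun u ↦ ∫ v in (0 : ℝ)..u, φ v with hg
  have hderiv : ∀ u, HasDerivAt g (φ u) u := fun u ↦
    (hφ_cont.integral_hasStrictDerivAt 0 u).hasDerivAt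
  have hdiff : ∀ u v, g v - g u = ∫ w in u..v, φ w := fun u v ↦
    integral_interval_sub_left (hii 0 v) (hii 0 u)
  have hgcd : ContDiff ℝ ∞ g := by
    refine contDiff_infty_iff_deriv.mpr ⟨fun u ↦ (hderiv u).differentiableAt, ?_⟩
    have : deriv g = φ := funext fun u ↦ (hderiv u).deriv
    rw [this]
    exact hφ_cd
  have hmono : StrictMono g := fun u v huv ↦ by
    have h := intervalIntegral_pos_of_pos_on (hii u v) (fun w _ ↦ hφ_pos w) huv
    linarith [hdiff u v]
  have hlip : ∀ u v, u ≤ v → g v - g u ≤ v - u := fun u v huv ↦ by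
    rw [hdiff u v]
    have h := integral_mono_on huv (hii u v) intervalIntegrable_const (fun w _ ↦ hφ_le w)
    rwa [intervalIntegral.integral_const, smul_eq_mul, mul_one] at h
  have hid : ∀ u, u ≤ 0 → g u = u := fun u hu ↦ by
    have h1 : ∫ v in (0 : ℝ)..u, φ v = ∫ _ in (0 : ℝ)..u, (1 : ℝ) := by
      refine integral_congr fun w hw ↦ ?_
      rw [uIcc_of_ge hu] at hw
      exact hφ_neg w hw.2
    simp only [hg]
    rw [h1, intervalIntegral.integral_const, smul_eq_mul, mul_one, sub_zero]
  have hg0 : g 0 = 0 := by simpa using hid 0 le_rfl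
  have hbound : ∀ u, g u < 1 / 2 := fun u ↦ by
    rcases le_or_gt u (1 / 4) with hu | hu
    · by_cases hu0 : u ≤ 0
      · rw [hid u hu0]; linarith
      · have h1 := hlip 0 u (not_le.mp hu0).le
        rw [hg0] at h1
        linarith
    · have h1 := hlip 0 (1 / 4) (by norm_num)
      rw [hg0] at h1
      have h2 : g u - g (1 / 4) = ∫ w in (1 / 4 : ℝ)..u, Real.exp (-4 * w) := by
        rw [hdiff]
        refine integral_congr fun w hw ↦ hφ_far w ?_
        rw [uIcc_of_le hu.le] at hw
        exact hw.1
      have h3 : ∫ w in (1 / 4 : ℝ)..u, Real.exp (-4 * w) =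
          Real.exp (-4 * u) * (-1 / 4) - Real.exp (-4 * (1 / 4)) * (-1 / 4) := by
        refine integral_eq_sub_of_hasDerivAt (f := fun w ↦ Real.exp (-4 * w) * (-1 / 4))
          (fun w _ ↦ ?_)
          ((Real.continuous_exp.comp (continuous_const.mul continuous_id)).intervalIntegrable _ _)
        have h1 : HasDerivAt (fun w : ℝ ↦ -4 * w) (-4) w := by
          simpa using (hasDerivAt_id w).const_mul (-4)
        exact (((Real.hasDerivAt_exp _).comp w h1).mul_const (-1 / 4)).congr_deriv (by ring)
      have h4 : Real.exp (-4 * (1 / 4)) < 1 := Real.exp_lt_one_iff.mpr (by norm_num)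
      have h5 : 0 < Real.exp (-4 * u) := Real.exp_pos _
      rw [h3] at h2
      linarith
  refine ⟨g, hgcd, hmono, hid, hbound, hlip, ?_⟩
  -- the range is an open half-line `(−∞, L)`
  have hbdd : BddAbove (range g) := ⟨1 / 2, by rintro _ ⟨u, rfl⟩; exact (hbound u).le⟩
  refine ⟨⨆ u, g u, fun u ↦ (hmono (lt_add_one u)).trans_le (le_ciSup hbdd (u + 1)),
    fun y hy ↦ ?_⟩
  obtain ⟨u₀, hu₀⟩ := exists_lt_of_lt_ciSup hy
  set u₁ : ℝ := min y 0 - 1 with hu₁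
  have hu₁0 : u₁ ≤ 0 := by rw [hu₁]; linarith [min_le_right y 0]
  have hgu₁ : g u₁ = u₁ := hid u₁ hu₁0
  have hu₁y : g u₁ < y := by rw [hgu₁, hu₁]; linarith [min_le_left y 0]
  have hle : u₁ ≤ u₀ := (hmono.lt_iff_lt.mp (hu₁y.trans hu₀)).le
  obtain ⟨u, -, hu⟩ := intermediate_value_Icc hle hgcd.continuous.continuousOn ⟨hu₁y.le, hu₀.le⟩
  exact ⟨u, hu⟩

/-! ## The hole-time push profile -/

/-- **Push profile.**  For every `a : ℝ` there is a `C^∞` function `ϑ` with `ϑ t = t` for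
`t ≥ a + 1`, `ϑ t > a` and `ϑ t ≥ t` for all `t`:
`ϑ t = t + (a + 1 − t)(1 − smoothTransition (t − a))`.  The seam pre-composes the re-gauged hole
charts with the push `t ↦ ϑ t` of the rest-frame time (identity on the late region) so that the
new charts are smooth on the whole boosted Kerr domain. [folklore] -/
theorem exists_pushProfile (a : ℝ) :
    ∃ ϑ : ℝ → ℝ, ContDiff ℝ ∞ ϑ ∧ (∀ t, a + 1 ≤ t → ϑ t = t) ∧ (∀ t, a < ϑ t) ∧ ∀ t, t ≤ ϑ t := by
  refine ⟨fun t ↦ t + (a + 1 - t) * (1 - Real.smoothTransition (t - a)), ?_, ?_, ?_, ?_⟩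
  · exact contDiff_id.add ((contDiff_const.sub contDiff_id).mul
      (contDiff_const.sub (Real.smoothTransition.contDiff.comp (contDiff_id.sub contDiff_const))))
  · intro t ht
    simp [Real.smoothTransition.one_of_one_le (by linarith : 1 ≤ t - a)]
  · intro t
    rcases le_or_gt t a with h | h
    · simp only [Real.smoothTransition.zero_of_nonpos (by linarith : t - a ≤ 0)]; linarith
    · rcases le_or_gt t (a + 1) with h' | h'
      · have h1 : 0 ≤ 1 - Real.smoothTransition (t - a) := by
          linarith [Real.smoothTransition.le_one (t - a)]
        nlinarith
      · simp only [Real.smoothTransition.one_of_one_le (by linarith : 1 ≤ t - a)]; linarith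
  · intro t
    rcases le_or_gt t (a + 1) with h | h
    · have h1 : 0 ≤ 1 - Real.smoothTransition (t - a) := by
        linarith [Real.smoothTransition.le_one (t - a)]
      nlinarith
    · simp only [Real.smoothTransition.one_of_one_le (by linarith : 1 ≤ t - a)]; linarith

end Summit.FinalStateConjecture.FinalStateConjecture.Theorems.NecksCertifyTwoCap.Seam

end
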